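import Literature.MathematicalPhysics.QuantumManyBody.EnergyLocalizationBoxBound
import HarnessLib

/-!
# LSSY Lemma 5.2, third layer: the cell method and superadditivity for the localized functional

Topic `Literature/MathematicalPhysics/QuantumManyBody`, companion of `EnergyLocalization.lean`
(named fact `LSSY2005_lemma52_periodic`) and of `LiebYngvasonCellMethod.lean` (the cell method
(2.52) and superadditivity (2.53) for the Neumann ground-state energy,
`LSSY2005_cellDecomposition_holds`, `LSSY2005_superadditivity_holds`).

For the localized functional `εT + (1-ε)(T^in_R + I)` of `EnergyLocalizationBoxBound.lean`
(`locEnergy`, `locGroundStateEnergy`) the two structural layers of the proof of Thm. 2.4 hold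
verbatim — "dividing `Λ` into cells with Neumann conditions on each of them can only lower the
energy … the interaction between particles in different boxes can be dropped" [LSSY2005, before
(2.52)] — because, in addition, the encounter region of a particle *within its group* is contained
in its encounter region among all particles (`nearSetOn_subset_nearSet`): restricting `T^in` to
groups can only lower it. This file proves

* `locSuperadditivity` — `E'(n + n', ℓ) ≥ E'(n, ℓ) + E'(n', ℓ)` (2.53);
* `locCellDecomposition` — `E'(N, Mℓ) ≥ inf_{∑ n_c = N} ∑_c E'(n_c, ℓ)` (2.52),

for `E' = locGroundStateEnergy ε R v`, following the tree's proofs for `E₀` (group extraction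
through `glueEquiv`, slices, scaling, the cell sets `cellSet`), with the pointwise densities
`locDensity` / `locDensityOn` in place of `|∇ψ|² + ∑v|ψ|²`.

## References

* [LSSY2005] E. H. Lieb, R. Seiringer, J. P. Solovej, J. Yngvason, *The Mathematics of the Bose
  Gas and its Condensation*, Oberwolfach Seminars 34, Birkhäuser 2005 (arXiv:cond-mat/0610117):
  (2.52)–(2.53) p. 16; Lemma 5.2 (5.9)–(5.14), p. 25.
-/

noncomputable section

open MeasureTheory Filter Metric
open scoped ENNReal NNReal

namespace Literature.MathematicalPhysics.QuantumManyBody.BoseGas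

/-! ### The localized density, globally and for a group of particles -/

/-- The pointwise **localized density** `ε|∇ψ|² + (1-ε)(∑ᵢ 1_{near,i}|∇ᵢψ|² + ∑_{i<j} v |ψ|²)`,
whose integral over `Λ^n` is `locEnergy`. [cite: LSSY2005, Lemma 5.2 (5.9)–(5.13)] -/
def locDensity (ε R : ℝ) (v : ℝ → ℝ≥0∞) {N : ℕ} (ψ : Config N → ℂ) (X : Config N) : ℝ≥0∞ :=
  ENNReal.ofReal ε * kineticDensity ψ X +
    ENNReal.ofReal (1 - ε) * (kineticInside R ψ X + interaction v X * (‖ψ X‖₊ : ℝ≥0∞) ^ 2)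

/-- The encounter region of the `i`-th particle of a group `ι` *within the group*:
`{X | ∃ j ≠ i, |x_{ι i} - x_{ι j}| < R}`. [cite: LSSY2005, Lemma 5.2 (5.13) and (2.52)] -/
def nearSetOn {n N : ℕ} (ι : Fin n → Fin N) (R : ℝ) (i : Fin n) : Set (Config N) :=
  {X | ∃ j, j ≠ i ∧ dist (X (ι i)) (X (ι j)) < R}

/-- `T^in` of a group: `∑_{i<n} 1_{nearSetOn ι R i} |∇_{ι i}ψ|²`. [cite: LSSY2005, Lemma 5.2 (5.11) and (2.52)] -/
def kineticInsideOn {n N : ℕ} (ι : Fin n → Fin N) (R : ℝ) (ψ : Config N → ℂ) (X : Config N) : ℝ≥0∞ :=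
  ∑ i : Fin n, (nearSetOn ι R i).indicator (partialGradSq (ι i) ψ) X

/-- The localized density of a group of particles. [cite: LSSY2005, Lemma 5.2 and (2.52)–(2.53)] -/
def locDensityOn {n N : ℕ} (ι : Fin n → Fin N) (ε R : ℝ) (v : ℝ → ℝ≥0∞) (ψ : Config N → ℂ)
    (X : Config N) : ℝ≥0∞ :=
  ENNReal.ofReal ε * kineticOn ι ψ X +
    ENNReal.ofReal (1 - ε) *
      (kineticInsideOn ι R ψ X + interactionOn ι v X * (‖ψ X‖₊ : ℝ≥0∞) ^ 2)

section Basic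

variable {n N : ℕ}

/-- `nearSetOn` is measurable. [folklore] -/
theorem measurableSet_nearSetOn (ι : Fin n → Fin N) (R : ℝ) (i : Fin n) :
    MeasurableSet (nearSetOn ι R i) := by
  have : nearSetOn ι R i = ⋃ j ∈ Finset.univ.erase i,
      {X : Config N | dist (X (ι i)) (X (ι j)) < R} := by
    ext X
    simp only [nearSetOn, Set.mem_setOf_eq, Set.mem_iUnion, Finset.mem_erase, Finset.mem_univ,
      and_true, exists_prop]
  rw [this]
  exact Finset.measurableSet_biUnion _ fun j _ =>
    measurableSet_lt ((measurable_config_apply _).dist (measurable_config_apply _)) measurable_const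

/-- `kineticInsideOn` is measurable. [folklore] -/
theorem measurable_kineticInsideOn (ι : Fin n → Fin N) (R : ℝ) (ψ : Config N → ℂ) :
    Measurable (kineticInsideOn ι R ψ) :=
  Finset.measurable_sum _ fun i _ =>
    (measurable_partialGradSq _ ψ).indicator (measurableSet_nearSetOn ι R i)

/-- `locDensity` is measurable. [folklore] -/
theorem measurable_locDensity (ε R : ℝ) {v : ℝ → ℝ≥0∞} (hv : Measurable v) {ψ : Config N → ℂ}
    (hψ : ContDiff ℝ 1 ψ) : Measurable (locDensity ε R v ψ) :=
  ((measurable_kineticDensity hψ).const_mul _).add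
    (((measurable_kineticInside R ψ).add
      ((measurable_interaction hv).mul (measurable_normSq hψ.continuous))).const_mul _)

/-- `locDensityOn` is measurable. [folklore] -/
theorem measurable_locDensityOn (ι : Fin n → Fin N) (ε R : ℝ) {v : ℝ → ℝ≥0∞} (hv : Measurable v)
    {ψ : Config N → ℂ} (hψ : ContDiff ℝ 1 ψ) : Measurable (locDensityOn ι ε R v ψ) :=
  ((measurable_kineticOn ι hψ).const_mul _).add
    (((measurable_kineticInsideOn ι R ψ).add
      ((measurable_interactionOn ι hv).mul (measurable_normSq hψ.continuous))).const_mul _)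

/-- The localized energy is the integral of the localized density.
[cite: LSSY2005, Lemma 5.2 (5.9)–(5.13)] -/
theorem locEnergy_eq_setLIntegral (ε R : ℝ) (v : ℝ → ℝ≥0∞) {ℓ : ℝ}
    (Ψ : NeumannTrialState N ℓ) :
    locEnergy ε R v Ψ = ∫⁻ X in boxN N ℓ, locDensity ε R v Ψ.ψ X := by
  unfold locEnergy locDensity
  rw [lintegral_add_left ((measurable_kineticDensity Ψ.contDiff).const_mul _),
    lintegral_const_mul' _ _ ENNReal.ofReal_ne_top, lintegral_const_mul' _ _ ENNReal.ofReal_ne_top]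

/-- Within-group encounters are encounters: `nearSetOn ι R i ⊆ nearSet R (ι i)` for injective `ι`.
[cite: LSSY2005, Lemma 5.2 (5.13)] -/
theorem nearSetOn_subset_nearSet (ι : Fin n ↪ Fin N) (R : ℝ) (i : Fin n) :
    nearSetOn ι R i ⊆ nearSet R (ι i) := by
  rintro X ⟨j, hj, hlt⟩
  exact ⟨ι j, fun h => hj (ι.injective h), hlt⟩

end Basic

/-! ### Slices -/

section Slice

variable {n N : ℕ}

/-- Encounters within the group are read off the slice: `Y ∈ nearSet R i ↔ glue(Y,Z) ∈ nearSetOn ι R i`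
(the gluing translates the whole group by `u`). [folklore] -/
theorem mem_nearSet_iff_glueEquiv (ι : Fin n ↪ Fin N) (u : Space) (R : ℝ)
    (Z : {j // j ∉ Set.range ι} → Space) (Y : Config n) (i : Fin n) :
    Y ∈ nearSet R i ↔ glueEquiv ι u (Y, Z) ∈ nearSetOn ι R i := by
  simp only [nearSet, nearSetOn, Set.mem_setOf_eq, glueEquiv_apply_ι, dist_add_left]

/-- The partial gradients of the slice are the group's partial gradients of `ψ`. [folklore] -/
theorem partialGradSq_slice (ι : Fin n ↪ Fin N) (u : Space) {ψ : Config N → ℂ}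
    (hψ : ContDiff ℝ 1 ψ) (Z : {j // j ∉ Set.range ι} → Space) (Y : Config n) (i : Fin n) :
    partialGradSq i (slice ι u ψ Z) Y = partialGradSq (ι i) ψ (glueEquiv ι u (Y, Z)) := by
  unfold partialGradSq slice
  have hd : fderiv ℝ (fun Y => ψ (glueEquiv ι u (Y, Z))) Y =
      (fderiv ℝ ψ (glueEquiv ι u (Y, Z))).comp (placeCLM ι) := by
    have h1 : HasFDerivAt ψ (fderiv ℝ ψ (glueEquiv ι u (Y, Z))) (glueEquiv ι u (Y, Z)) :=
      ((hψ.differentiable one_ne_zero) _).hasFDerivAt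
    exact (h1.comp Y (hasFDerivAt_glueEquiv ι u Z Y)).fderiv
  simp only [hd, ContinuousLinearMap.coe_comp, Function.comp_apply, placeCLM_single]

/-- `T^in` of the slice is the group's `T^in` of `ψ`. [cite: LSSY2005, Lemma 5.2 and (2.52)] -/
theorem kineticInside_slice (ι : Fin n ↪ Fin N) (u : Space) (R : ℝ) {ψ : Config N → ℂ}
    (hψ : ContDiff ℝ 1 ψ) (Z : {j // j ∉ Set.range ι} → Space) (Y : Config n) :
    kineticInside R (slice ι u ψ Z) Y = kineticInsideOn ι R ψ (glueEquiv ι u (Y, Z)) := by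
  unfold kineticInside kineticInsideOn
  refine Finset.sum_congr rfl fun i _ => ?_
  by_cases h : Y ∈ nearSet R i
  · rw [Set.indicator_of_mem h, Set.indicator_of_mem ((mem_nearSet_iff_glueEquiv ι u R Z Y i).1 h),
      partialGradSq_slice ι u hψ Z Y i]
  · rw [Set.indicator_of_notMem h,
      Set.indicator_of_notMem (mt (mem_nearSet_iff_glueEquiv ι u R Z Y i).2 h)]

/-- The localized density of the slice is the group's localized density of `ψ`.
[cite: LSSY2005, Lemma 5.2 and (2.52)–(2.53)] -/
theorem locDensity_slice (ι : Fin n ↪ Fin N) (u : Space) (ε R : ℝ) (v : ℝ → ℝ≥0∞)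
    {ψ : Config N → ℂ} (hψ : ContDiff ℝ 1 ψ) (Z : {j // j ∉ Set.range ι} → Space) (Y : Config n) :
    locDensity ε R v (slice ι u ψ Z) Y = locDensityOn ι ε R v ψ (glueEquiv ι u (Y, Z)) := by
  unfold locDensity locDensityOn
  rw [kineticDensity_slice ι u hψ Z Y, kineticInside_slice ι u R hψ Z Y,
    interaction_eq_interactionOn_glueEquiv ι u v Z Y]
  rfl

end Slice

/-! ### Scaling and the group extraction inequality -/

section Scaling

variable {n : ℕ}

/-- Scaling a wave function by a real constant `c ≥ 0` scales each partial gradient by `c²`.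
[folklore] -/
theorem partialGradSq_const_mul {φ : Config n → ℂ} (hφ : ContDiff ℝ 1 φ) (c : ℝ) (hc : 0 ≤ c)
    (i : Fin n) (Y : Config n) :
    partialGradSq i (fun Y => (c : ℂ) * φ Y) Y = ENNReal.ofReal (c ^ 2) * partialGradSq i φ Y := by
  unfold partialGradSq
  rw [fderiv_const_mul ((hφ.differentiable one_ne_zero) Y)]
  simp only [_root_.smul_apply, smul_eq_mul, ennorm_real_mul_sq c hc, Finset.mul_sum]

/-- Scaling scales `T^in` by `c²`. [folklore] -/
theorem kineticInside_const_mul {φ : Config n → ℂ} (hφ : ContDiff ℝ 1 φ) (c : ℝ) (hc : 0 ≤ c)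
    (R : ℝ) (Y : Config n) :
    kineticInside R (fun Y => (c : ℂ) * φ Y) Y = ENNReal.ofReal (c ^ 2) * kineticInside R φ Y := by
  unfold kineticInside
  rw [Finset.mul_sum]
  refine Finset.sum_congr rfl fun i _ => ?_
  by_cases h : Y ∈ nearSet R i
  · rw [Set.indicator_of_mem h, Set.indicator_of_mem h, partialGradSq_const_mul hφ c hc]
  · rw [Set.indicator_of_notMem h, Set.indicator_of_notMem h, mul_zero]

/-- Scaling scales the localized density by `c²`. [folklore] -/
theorem locDensity_const_mul (ε R : ℝ) (v : ℝ → ℝ≥0∞) {φ : Config n → ℂ} (hφ : ContDiff ℝ 1 φ)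
    (c : ℝ) (hc : 0 ≤ c) (Y : Config n) :
    locDensity ε R v (fun Y => (c : ℂ) * φ Y) Y = ENNReal.ofReal (c ^ 2) * locDensity ε R v φ Y := by
  unfold locDensity
  rw [kineticDensity_const_mul hφ c hc, kineticInside_const_mul hφ c hc, ennorm_real_mul_sq c hc]
  ring

/-- **Scaling.** For any `C¹` function `φ` on `Λ_ℓ^n` (not necessarily normalised),
`E'(n, ℓ) · ∫_{Λ^n} |φ|² ≤ ∫_{Λ^n} locDensity φ`. [cite: LSSY2005, (2.3) and (2.52)–(2.53)] -/
theorem locGroundStateEnergy_mul_normSq_le (ε R : ℝ) {ℓ : ℝ} (v : ℝ → ℝ≥0∞)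
    {φ : Config n → ℂ} (hφ : ContDiff ℝ 1 φ) :
    locGroundStateEnergy ε R v n ℓ * ∫⁻ Y in boxN n ℓ, (‖φ Y‖₊ : ℝ≥0∞) ^ 2 ≤
      ∫⁻ Y in boxN n ℓ, locDensity ε R v φ Y := by
  set m := ∫⁻ Y in boxN n ℓ, (‖φ Y‖₊ : ℝ≥0∞) ^ 2 with hm_def
  have hmtop : m ≠ ⊤ := (lintegral_boxN_normSq_lt_top hφ.continuous ℓ).ne
  rcases eq_or_ne m 0 with hm0 | hm0
  · simp [hm0]
  have hmpos : 0 < m.toReal := ENNReal.toReal_pos hm0 hmtop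
  set c : ℝ := Real.sqrt (m.toReal)⁻¹ with hc_def
  have hc0 : 0 ≤ c := Real.sqrt_nonneg _
  have hc2 : ENNReal.ofReal (c ^ 2) = m⁻¹ := by
    rw [hc_def, Real.sq_sqrt (inv_nonneg.2 hmpos.le), ENNReal.ofReal_inv_of_pos hmpos,
      ENNReal.ofReal_toReal hmtop]
  -- the normalised trial state
  let Ψ : NeumannTrialState n ℓ :=
    { ψ := fun Y => (c : ℂ) * φ Y
      contDiff := contDiff_const.mul hφ
      norm_eq := by
        simp only [ennorm_real_mul_sq c hc0]
        rw [lintegral_const_mul' _ _ ENNReal.ofReal_ne_top, hc2]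
        exact ENNReal.inv_mul_cancel hm0 hmtop }
  have hE : locEnergy ε R v Ψ = m⁻¹ * ∫⁻ Y in boxN n ℓ, locDensity ε R v φ Y := by
    rw [locEnergy_eq_setLIntegral ε R v Ψ, ← hc2, ← lintegral_const_mul' _ _ ENNReal.ofReal_ne_top]
    refine lintegral_congr fun Y => ?_
    exact locDensity_const_mul ε R v hφ c hc0 Y
  calc locGroundStateEnergy ε R v n ℓ * m ≤ locEnergy ε R v Ψ * m :=
        mul_le_mul_left (locGroundStateEnergy_le ε R v Ψ) m
    _ = _ := by
        rw [hE, mul_comm m⁻¹, mul_assoc, ENNReal.inv_mul_cancel hm0 hmtop, mul_one]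

end Scaling

section Group

variable {n N : ℕ}

/-- **Extracting a group of particles (localized functional).** As
`neumannGroundStateEnergy_mul_le_setLIntegral_group`: on the region where the group `ι` sits in
`u + Λ_ℓ` and the other particles in `A`, `∫ locDensityOn ι ≥ E'(n, ℓ) ∫ |ψ|²`.
[cite: LSSY2005, (2.52)–(2.53)] -/
theorem locGroundStateEnergy_mul_le_setLIntegral_group (ι : Fin n ↪ Fin N) (u : Space)
    (ε R ℓ : ℝ) {v : ℝ → ℝ≥0∞} (hv : Measurable v) {ψ : Config N → ℂ} (hψ : ContDiff ℝ 1 ψ)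
    (A : Set ({j // j ∉ Set.range ι} → Space)) :
    locGroundStateEnergy ε R v n ℓ *
        ∫⁻ X in {X | (∀ i, X (ι i) - u ∈ box ℓ) ∧ (fun j : {j // j ∉ Set.range ι} => X j) ∈ A},
          (‖ψ X‖₊ : ℝ≥0∞) ^ 2 ≤
      ∫⁻ X in {X | (∀ i, X (ι i) - u ∈ box ℓ) ∧ (fun j : {j // j ∉ Set.range ι} => X j) ∈ A},
        locDensityOn ι ε R v ψ X := by
  set T := {X : Config N | (∀ i, X (ι i) - u ∈ box ℓ) ∧
    (fun j : {j // j ∉ Set.range ι} => X j) ∈ A} with hT_def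
  set g := glueEquiv ι u with hg_def
  have hg := volume_preserving_glueEquiv ι u
  have hT : g ⁻¹' T = boxN n ℓ ×ˢ A := by
    ext ⟨Y, Z⟩
    have hZ : (fun j : {j // j ∉ Set.range ι} => glueEquiv ι u (Y, Z) j) = Z :=
      funext fun j => glueEquiv_apply_of_not_mem ι u Y Z j j.2
    simp only [hT_def, hg_def, Set.mem_preimage, Set.mem_setOf_eq, glueEquiv_apply_ι,
      add_sub_cancel_left, hZ, Set.mem_prod, boxN]
  have hcv : ∀ F : Config N → ℝ≥0∞,
      ∫⁻ X in T, F X = ∫⁻ p in boxN n ℓ ×ˢ A, F (g p) ∂(volume.prod volume) := by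
    intro F
    rw [← hT, ← Measure.volume_eq_prod]
    exact (hg.setLIntegral_comp_preimage_emb g.measurableEmbedding F T).symm
  have hF : Measurable (locDensityOn ι ε R v ψ) := measurable_locDensityOn ι ε R hv hψ
  have hn2 : Measurable fun X => (‖ψ X‖₊ : ℝ≥0∞) ^ 2 := measurable_normSq hψ.continuous
  rw [hcv, hcv,
    setLIntegral_prod_symm (fun p => (‖ψ (g p)‖₊ : ℝ≥0∞) ^ 2)
      (hn2.comp g.measurable).aemeasurable,
    setLIntegral_prod_symm (fun p => locDensityOn ι ε R v ψ (g p)) (hF.comp g.measurable).aemeasurable]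
  refine le_trans (lintegral_const_mul_le _ _) (lintegral_mono fun Z => ?_)
  -- for a frozen configuration `Z` of the other particles: the slice
  have key := locGroundStateEnergy_mul_normSq_le ε R (ℓ := ℓ) v (contDiff_slice ι u hψ Z)
  refine le_trans (le_of_eq rfl) (key.trans (le_of_eq (lintegral_congr fun Y => ?_)))
  exact locDensity_slice ι u ε R v hψ Z Y

end Group

/-! ### Superadditivity (2.53) for the localized functional -/

section Superadditivity

variable {n n' : ℕ}

/-- Splitting `n + n'` particles into the first `n` and the last `n'`: the groups' `T^in` add up
to at most `T^in`. [cite: LSSY2005, (2.53) and Lemma 5.2 (5.13)] -/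
theorem kineticInsideOn_castAdd_add_natAdd_le (R : ℝ) (ψ : Config (n + n') → ℂ)
    (X : Config (n + n')) :
    kineticInsideOn (Fin.castAddEmb n' : Fin n ↪ Fin (n + n')) R ψ X +
        kineticInsideOn (Fin.natAddEmb n : Fin n' ↪ Fin (n + n')) R ψ X ≤
      kineticInside R ψ X := by
  unfold kineticInside kineticInsideOn
  rw [Fin.sum_univ_add]
  refine add_le_add (Finset.sum_le_sum fun i _ => ?_) (Finset.sum_le_sum fun i _ => ?_)
  · exact Set.indicator_le_indicator_of_subset
      (nearSetOn_subset_nearSet (Fin.castAddEmb n') R i) (fun _ => zero_le) X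
  · exact Set.indicator_le_indicator_of_subset
      (nearSetOn_subset_nearSet (Fin.natAddEmb n) R i) (fun _ => zero_le) X

/-- The two groups' localized densities add up to at most the localized density.
[cite: LSSY2005, (2.53) and Lemma 5.2] -/
theorem locDensityOn_castAdd_add_natAdd_le (ε R : ℝ) (v : ℝ → ℝ≥0∞) (ψ : Config (n + n') → ℂ)
    (X : Config (n + n')) :
    locDensityOn (Fin.castAddEmb n' : Fin n ↪ Fin (n + n')) ε R v ψ X +
        locDensityOn (Fin.natAddEmb n : Fin n' ↪ Fin (n + n')) ε R v ψ X ≤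
      locDensity ε R v ψ X := by
  have hk := kineticDensity_eq_kineticOn_add ψ X
  have hi := interactionOn_add_le_interaction v X
  have hin := kineticInsideOn_castAdd_add_natAdd_le R ψ X
  unfold locDensityOn locDensity
  calc _ = ENNReal.ofReal ε * (kineticOn (Fin.castAdd n') ψ X + kineticOn (Fin.natAdd n) ψ X) +
        ENNReal.ofReal (1 - ε) *
          ((kineticInsideOn (Fin.castAddEmb n' : Fin n ↪ Fin (n + n')) R ψ X +
            kineticInsideOn (Fin.natAddEmb n : Fin n' ↪ Fin (n + n')) R ψ X) +
          (interactionOn (Fin.castAdd n') v X + interactionOn (Fin.natAdd n) v X) *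
            (‖ψ X‖₊ : ℝ≥0∞) ^ 2) := by
        change (ENNReal.ofReal ε * kineticOn (Fin.castAdd n') ψ X + ENNReal.ofReal (1 - ε) *
            (kineticInsideOn (Fin.castAddEmb n' : Fin n ↪ Fin (n + n')) R ψ X +
              interactionOn (Fin.castAdd n') v X * _)) +
          (ENNReal.ofReal ε * kineticOn (Fin.natAdd n) ψ X + ENNReal.ofReal (1 - ε) *
            (kineticInsideOn (Fin.natAddEmb n : Fin n' ↪ Fin (n + n')) R ψ X +
              interactionOn (Fin.natAdd n) v X * _)) = _
        ring
    _ ≤ _ := by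
        rw [hk]; gcongr

/-- **(2.53) for the localized functional**: `E'(n + n', ℓ) ≥ E'(n, ℓ) + E'(n', ℓ)`.
[cite: LSSY2005, (2.53) and Lemma 5.2 (5.14)] -/
theorem locSuperadditivity (ε R : ℝ) {v : ℝ → ℝ≥0∞} (hv : Measurable v) (n n' : ℕ) (ℓ : ℝ) :
    locGroundStateEnergy ε R v n ℓ + locGroundStateEnergy ε R v n' ℓ ≤
      locGroundStateEnergy ε R v (n + n') ℓ := by
  refine le_iInf fun Ψ => ?_
  have h1 := locGroundStateEnergy_mul_le_setLIntegral_group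
    (Fin.castAddEmb n' : Fin n ↪ Fin (n + n')) 0 ε R ℓ hv Ψ.contDiff {Z | ∀ j, Z j ∈ box ℓ}
  have h2 := locGroundStateEnergy_mul_le_setLIntegral_group
    (Fin.natAddEmb n : Fin n' ↪ Fin (n + n')) 0 ε R ℓ hv Ψ.contDiff {Z | ∀ j, Z j ∈ box ℓ}
  rw [setOf_castAddEmb_eq_boxN, Ψ.norm_eq, mul_one] at h1
  rw [setOf_natAddEmb_eq_boxN, Ψ.norm_eq, mul_one] at h2
  calc locGroundStateEnergy ε R v n ℓ + locGroundStateEnergy ε R v n' ℓ ≤ _ := add_le_add h1 h2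
    _ = ∫⁻ X in boxN (n + n') ℓ,
          locDensityOn (Fin.castAddEmb n' : Fin n ↪ Fin (n + n')) ε R v Ψ.ψ X +
            locDensityOn (Fin.natAddEmb n : Fin n' ↪ Fin (n + n')) ε R v Ψ.ψ X :=
        (lintegral_add_left (measurable_locDensityOn _ ε R hv Ψ.contDiff) _).symm
    _ ≤ ∫⁻ X in boxN (n + n') ℓ, locDensity ε R v Ψ.ψ X :=
        lintegral_mono fun X => locDensityOn_castAdd_add_natAdd_le ε R v Ψ.ψ X
    _ = locEnergy ε R v Ψ := (locEnergy_eq_setLIntegral ε R v Ψ).symm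

end Superadditivity

/-! ### The cell method (2.52) for the localized functional -/

section Cells

variable {N M : ℕ}

/-- Grouping the particles by a labelling `σ`: the groups' `T^in` add up to at most `T^in`.
[cite: LSSY2005, (2.52) and Lemma 5.2 (5.13)] -/
theorem sum_kineticInsideOn_le_kineticInside {K : ℕ} (σ : Fin N → Fin K) (R : ℝ)
    (ψ : Config N → ℂ) (X : Config N) :
    ∑ c : Fin K, kineticInsideOn
        ((Finset.univ.filter fun i => σ i = c).orderEmbOfFin rfl).toEmbedding R ψ X ≤
      kineticInside R ψ X := by
  unfold kineticInside kineticInsideOn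
  rw [← Finset.sum_fiberwise Finset.univ σ]
  refine Finset.sum_le_sum fun c _ => ?_
  set s := Finset.univ.filter fun i => σ i = c
  set ι : Fin s.card ↪ Fin N := (s.orderEmbOfFin rfl).toEmbedding with hι
  -- compare with the same group's terms of `kineticInside`, then re-index
  calc ∑ i : Fin s.card, (nearSetOn ι R i).indicator (partialGradSq (ι i) ψ) X
      ≤ ∑ i : Fin s.card, (nearSet R (ι i)).indicator (partialGradSq (ι i) ψ) X :=
        Finset.sum_le_sum fun i _ => Set.indicator_le_indicator_of_subset
          (nearSetOn_subset_nearSet ι R i) (fun _ => zero_le) X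
    _ = ∑ i ∈ s, (nearSet R i).indicator (partialGradSq i ψ) X := by
        rw [← Finset.sum_coe_sort s]
        exact Fintype.sum_equiv (s.orderIsoOfFin rfl).toEquiv _ _ fun i => rfl

/-- The groups' localized densities add up to at most the localized density.
[cite: LSSY2005, (2.52) and Lemma 5.2] -/
theorem sum_locDensityOn_le_locDensity {K : ℕ} (σ : Fin N → Fin K) (ε R : ℝ) (v : ℝ → ℝ≥0∞)
    (ψ : Config N → ℂ) (X : Config N) :
    ∑ c : Fin K, locDensityOn
        ((Finset.univ.filter fun i => σ i = c).orderEmbOfFin rfl).toEmbedding ε R v ψ X ≤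
      locDensity ε R v ψ X := by
  unfold locDensityOn locDensity
  rw [Finset.sum_add_distrib, ← Finset.mul_sum, ← Finset.mul_sum, Finset.sum_add_distrib,
    ← Finset.sum_mul]
  have hk := kineticDensity_eq_sum_kineticOn σ ψ X
  have hi := sum_interactionOn_le_interaction σ v X
  have hin := sum_kineticInsideOn_le_kineticInside σ R ψ X
  exact add_le_add (mul_le_mul_right (le_of_eq hk.symm) _)
    (mul_le_mul_right (add_le_add hin (mul_le_mul_left hi _)) _)

/-- On each cell set, the localized density dominates `∑_c E'(n_c, ℓ)` times the mass.
[cite: LSSY2005, (2.52)] -/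
theorem sum_locGroundStateEnergy_mul_le_setLIntegral_cellSet (ε R : ℝ) {ℓ : ℝ} {v : ℝ → ℝ≥0∞}
    (hv : Measurable v) {ψ : Config N → ℂ} (hψ : ContDiff ℝ 1 ψ) (σ : Fin N → Fin (M ^ 3)) :
    (∑ c : Fin (M ^ 3), locGroundStateEnergy ε R v (Finset.univ.filter fun i => σ i = c).card ℓ) *
        ∫⁻ X in cellSet M ℓ σ, (‖ψ X‖₊ : ℝ≥0∞) ^ 2 ≤
      ∫⁻ X in cellSet M ℓ σ, locDensity ε R v ψ X := by
  rw [Finset.sum_mul]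
  have hc : ∀ c : Fin (M ^ 3),
      locGroundStateEnergy ε R v (Finset.univ.filter fun i => σ i = c).card ℓ *
          ∫⁻ X in cellSet M ℓ σ, (‖ψ X‖₊ : ℝ≥0∞) ^ 2 ≤
        ∫⁻ X in cellSet M ℓ σ, locDensityOn
          ((Finset.univ.filter fun i => σ i = c).orderEmbOfFin rfl).toEmbedding ε R v ψ X := by
    intro c
    have h := locGroundStateEnergy_mul_le_setLIntegral_group
      ((Finset.univ.filter fun i => σ i = c).orderEmbOfFin rfl).toEmbedding (cellCorner M ℓ c)
      ε R ℓ hv hψ {Z | ∀ j, Z j - cellCorner M ℓ (σ j) ∈ box ℓ}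
    rw [setOf_group_eq_cellSet M ℓ σ c] at h
    exact h
  refine (Finset.sum_le_sum fun c _ => hc c).trans ?_
  rw [← lintegral_finsetSum Finset.univ fun c _ => measurable_locDensityOn _ ε R hv hψ]
  exact lintegral_mono fun X => sum_locDensityOn_le_locDensity σ ε R v ψ X

/-- **(2.52) for the localized functional**: the cell method,
`E'(N, Mℓ) ≥ inf_{∑ n_c = N} ∑_c E'(n_c, ℓ)`. [cite: LSSY2005, (2.52) and Lemma 5.2 (5.14)] -/
theorem locCellDecomposition (ε R : ℝ) {v : ℝ → ℝ≥0∞} (hv : Measurable v) (N M : ℕ) {ℓ : ℝ}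
    (hM : 0 < M) (hℓ : 0 < ℓ) :
    ⨅ (m : Fin (M ^ 3) → ℕ) (_ : ∑ c, m c = N), ∑ c, locGroundStateEnergy ε R v (m c) ℓ ≤
      locGroundStateEnergy ε R v N (M * ℓ) := by
  refine le_iInf fun Ψ => ?_
  set I := ⨅ (m : Fin (M ^ 3) → ℕ) (_ : ∑ c, m c = N), ∑ c, locGroundStateEnergy ε R v (m c) ℓ
    with hI
  -- the mass of `Ψ` splits over the cells
  have hw : ∑ σ : Fin N → Fin (M ^ 3), ∫⁻ X in cellSet M ℓ σ, (‖Ψ.ψ X‖₊ : ℝ≥0∞) ^ 2 = 1 := by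
    rw [← Ψ.norm_eq, setLIntegral_congr (boxN_ae_eq_iUnion_cellSet (N := N) hℓ hM),
      lintegral_iUnion (fun σ => measurableSet_cellSet M ℓ σ) (pairwiseDisjoint_cellSet hℓ),
      tsum_fintype]
  -- on each cell set, `I · mass ≤ energy`
  have hσ : ∀ σ : Fin N → Fin (M ^ 3),
      I * ∫⁻ X in cellSet M ℓ σ, (‖Ψ.ψ X‖₊ : ℝ≥0∞) ^ 2 ≤
        ∫⁻ X in cellSet M ℓ σ, locDensity ε R v Ψ.ψ X := by
    intro σ
    refine le_trans (mul_le_mul_left ?_ _)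
      (sum_locGroundStateEnergy_mul_le_setLIntegral_cellSet ε R hv Ψ.contDiff σ)
    refine iInf₂_le (fun c => (Finset.univ.filter fun i => σ i = c).card) ?_
    exact (Finset.card_eq_sum_card_fiberwise (f := σ) (s := Finset.univ) (t := Finset.univ)
      fun _ _ => Finset.mem_univ _).symm.trans (by simp)
  calc I = I * ∑ σ : Fin N → Fin (M ^ 3), ∫⁻ X in cellSet M ℓ σ, (‖Ψ.ψ X‖₊ : ℝ≥0∞) ^ 2 := by
        rw [hw, mul_one]
    _ = ∑ σ : Fin N → Fin (M ^ 3), I * ∫⁻ X in cellSet M ℓ σ, (‖Ψ.ψ X‖₊ : ℝ≥0∞) ^ 2 :=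
        Finset.mul_sum _ _ _
    _ ≤ ∑ σ : Fin N → Fin (M ^ 3), ∫⁻ X in cellSet M ℓ σ, locDensity ε R v Ψ.ψ X :=
        Finset.sum_le_sum fun σ _ => hσ σ
    _ = ∫⁻ X in ⋃ σ : Fin N → Fin (M ^ 3), cellSet M ℓ σ, locDensity ε R v Ψ.ψ X := by
        rw [lintegral_iUnion (fun σ => measurableSet_cellSet M ℓ σ) (pairwiseDisjoint_cellSet hℓ),
          tsum_fintype]
    _ ≤ ∫⁻ X in boxN N (M * ℓ), locDensity ε R v Ψ.ψ X :=
        lintegral_mono_set (Set.iUnion_subset fun σ => cellSet_subset_boxN hℓ σ)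
    _ = locEnergy ε R v Ψ := (locEnergy_eq_setLIntegral ε R v Ψ).symm

end Cells

end Literature.MathematicalPhysics.QuantumManyBody.BoseGas

end
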